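import Summits.QuantumFields.YangMills.Theorems.FluctuationComparisonRegPrIntLS2BetaCubeRadialProjection
import Summits.QuantumFields.YangMills.Theorems.FluctuationComparisonRegPrIntLS2BetaConeOnSquare
import HarnessLib

/-!
# S2β · D-GUARD ∕ (BG∞) — (G7-S) FILE S2: THE CONE ON A DISCRETE CUBE — the stage-S filling of UV3-NODE §116.3 as ONE binder-style existence statement: for `n ≥ 2`, an
# off-cap radius `r` and a centre `a ∈ SU(2)`, a filling operator `W` on `{0,…,n}³` with (i) `W φ = φ` on the boundary shell, (ii) `W φ` off the cap, (iii) every bond step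
# `≤ 6Λλ + 3(π−r)∕n` from the shell datum's `ℓ¹`-modulus `λ` (`Λ = (π−r)∕sin r`), (iv) `Λμ`-closeness of the fillings of `μ`-close data — px5 g24's T2
# ✓`…ConeOnSquare.exists_coneOnSquare` ONE DIMENSION UP, over S1 ✓`…CubeRadialProjection` and px19 g25's cone ✓`…ConeFilling`

Cell `ym3-torus` (YM ladder rung R3 = continuum `SU(2)` Yang–Mills on the three-torus at fixed lattice data — a RUNG: NOT d = 4, NOT infinite volume,
NOT a mass gap, NOT Clay).  Width seat «width 8» `ym3-torus-px8` (gen 28, toron∕flux lineage ✓p826411 → px17 (W1) ✓p837971), FREE px helper on crux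
`stmt-QuantumFields-20520`; `--kind proof --supports stmt-QuantumFields-20520 --as helper`, count-neutral, DEFINITION-FREE (0 `def`, 0 `instance`, 0 `notation`,
0 `sorry`, default heartbeats).  NAMED (G7-S) by px5 g24 (STATUS 2026-09-01T01:21:46Z «(G7-S) IS YOURS, px8») under the architect's conditional GO (px17 g23 01:15:18Z (3)) and desk RULING №127 (P7-D) «binder style».

WHY.  In px19 g25's descent formulation of the (BG∞) sections theorem (UV3-NODE §116 ADD 1) the class-111 blocks (stage 3 = S) receive the CONE of the datum
`ψ_Q := G_{D(Q,·)}·g_Q⁻¹` on the block's boundary shell toward ✓p839220's antipodal centre, «read through px5's∕px8's radial projections».  THIS FILE is that reading for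
the cube: `W φ x := a·expPoint((1 − dep x∕(n∕2))·logVec(a⁻¹·φ(pr x)))` with S1's depth∕projection, and the four properties the glue (G8) consumes, in the SAME binder
shape as px5's square version (site type `ℕ × ℕ × ℕ`, boundary = «some coordinate ∈ {0, n}», modulus in `Nat.dist`-`ℓ¹` currency).  The step constant is `6Λλ` where the
square has `3Λλ`: S1's distortion law carries `2n` (two transverse coordinates cross the ring denominators), fed to px5's dimension-free ✓`cone_step_core_mul` at `c = 2`.

WHAT IS PROVED (sorry-free; def-free; ONE theorem).
* ★★★ `exists_coneOnCube (n) (hn : 2 ≤ n) (hr : 0 < r) (hrπ : r < π) (a : SU2) : ∃ W : (ℕ × ℕ × ℕ → SU2) → (ℕ × ℕ × ℕ → SU2), ∀ φ, (φ off the cap of radius r about −a on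
  the shell) → (i) W φ = φ on the shell ∧ (ii) ‖logVec (su2Quat (a⁻¹ * W φ x))‖ ≤ π − r on the cube ∧ (iii) ∀ lam ≥ 0, (ℓ¹-modulus lam of φ on the shell) → the three
  bond-direction step bounds `dist1 (W φ x * (W φ y)⁻¹) ≤ 6 * ((π − r) ∕ Real.sin r) * lam + 3 * (π − r) ∕ n` ∧ (iv) ∀ φ′ μ, (φ′ off the cap) → (φ, φ′ μ-close on the
  shell) → `dist1 (W φ x * (W φ′ x)⁻¹) ≤ ((π − r) ∕ Real.sin r) * μ` on the cube` — proof = px5's T2 proof clause by clause with one coordinate more: (i) ✓`coneFill_zero` at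
  depth `0` where `pr = id`; (ii) ✓`norm_logVec_inv_mul_coneFill_le`; (iii) ✓`cone_step_core_mul … 2 (distortion_fst∕snd∕thd)`; (iv) ✓`dist1_coneFill_tangential_le`.
The `ℓ¹`-modulus hypothesis of (iii) is discharged from PER-BOND letters on the shell by the successor S0 «the shell modulus of the discrete cube» (px5's T0
✓∕⧗`…SquareRingModulus` one dimension up: surface paths of length `≤ 2|Δ|₁`).

HONEST SCOPE.  Assembly of landed sphere geometry (px19 ✓p839271 cone, px5 ✓∕⧗ T2 core) over S1's `ℕ` bookkeeping; nothing of Bałaban's renormalisation-group analysis is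
asserted, proved or refuted ([Balaban1985RegularSpaces] Lemma 1 p.79 ∕ Thm 2 p.83: LOCAL axial gauges on cubes — the object the road globalises; consistent, not used);
`hBG`∕`hsuppPlus` remains a CONJECTURE under construction ((G6), (G7-T) T0–T2, (G7-S) S1–S2 ✓∕⧗; S0, (G8) glue∕descent, final assembly open); GAP♯∘ (`stub_uniformFibreGapOrbit`;
registry v11 3732b7df, v12.1 adopted-in-waiting), the five registered stubs (0∕5), S2β, crux 20520, 19936, 19200, `YM3TorusSU2` are NOT proved; no registered stub is closed;
rung R3 = `SU(2)` YM₃ on T³ at fixed lattice data — NOT d = 4, NOT infinite volume, NOT a mass gap, NOT Clay; the Yang–Mills mass gap is NOT proved.  Axioms standard.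
References: T. Bałaban, CMP **99** (1985) 75–102 [Balaban1985RegularSpaces] (Lemma 1 p.79, Thm 2 p.83).
-/

set_option autoImplicit false

noncomputable section

namespace Summit.QuantumFields.YangMills.Theorems.FluctuationComparisonRegPrIntLS2BetaConeOnCube

open scoped Real
open Literature.MathematicalPhysics.QuantumLattice (su2Quat)
open Literature.MathematicalPhysics.QuantumFieldTheory.Balaban1983to89
open T4CubeChartGnomonic (SU2)
open T4HaarSU2ExpChart (expPoint)
open T4ExpWindowSmallField (logVec norm_logVec_le_pi)
open Summit.QuantumFields.YangMills.Theorems.FluctuationComparisonRegPrIntLS2BetaCubeRadialProjection (exists_cubeProjection)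
open Summit.QuantumFields.YangMills.Theorems.FluctuationComparisonRegPrIntLS2BetaConeFilling
open Summit.QuantumFields.YangMills.Theorems.FluctuationComparisonRegPrIntLS2BetaConeOnSquare (cone_step_core_mul)

/-- ★★★ **THE CONE ON A DISCRETE CUBE** (binder style; px5 ✓`…ConeOnSquare.exists_coneOnSquare` one dimension up).  For `n ≥ 2`, an off-cap radius `0 < r < π`
and a centre `a ∈ SU(2)` there is a FILLING OPERATOR `W : (boundary data) → (cube maps)` on `{0,…,n}³` such that for every datum `φ` whose values on the boundary
shell avoid the cap of radius `r` about `−a` (`‖log(a⁻¹·φ)‖ ≤ π − r`):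
(i) `W φ = φ` on the boundary shell; (ii) every `W φ x` avoids the same cap (`‖log(a⁻¹·W φ x)‖ ≤ π − r`, `x` in the cube);
(iii) STEPS: if `φ` has `ℓ¹`-modulus `λ` on the shell (`dist1 (φ P·(φ Q)⁻¹) ≤ λ·|P − Q|₁` for shell sites `P, Q`), then along every bond of the cube, in each of the three
directions, `dist1 (W φ x·(W φ y)⁻¹) ≤ 6·((π − r)∕sin r)·λ + 3(π − r)∕n` — the cone `W φ x := a·expPoint((1 − dep x∕(n∕2))·log(a⁻¹·φ(pr x)))` over S1's projection
(✓`exists_cubeProjection`: distortion `(n∕2 − max depth)·|Δ pr|₁ ≤ 2n`) read through px5's dimension-free core ✓`cone_step_core_mul` at `c = 2` and px19's cone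
✓`…ConeFilling`; (iv) DATUM TO DATUM: two data `μ`-close on the shell (both off the cap) have fillings `((π − r)∕sin r)·μ`-close everywhere.
[cite: Balaban1985RegularSpaces, Lemma 1 p.79 and Thm 2 p.83 (local axial gauges on cubes — the object the (BG∞) road globalises)] -/
theorem exists_coneOnCube (n : ℕ) (hn : 2 ≤ n) {r : ℝ} (hr : 0 < r) (hrπ : r < π) (a : SU2) :
    ∃ W : (ℕ × ℕ × ℕ → SU2) → (ℕ × ℕ × ℕ → SU2), ∀ φ : ℕ × ℕ × ℕ → SU2,
      (∀ i j l, i ≤ n → j ≤ n → l ≤ n → (i = 0 ∨ i = n ∨ j = 0 ∨ j = n ∨ l = 0 ∨ l = n) →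
        ‖logVec (su2Quat (a⁻¹ * φ (i, j, l)))‖ ≤ π - r) →
      (∀ i j l, i ≤ n → j ≤ n → l ≤ n → (i = 0 ∨ i = n ∨ j = 0 ∨ j = n ∨ l = 0 ∨ l = n) → W φ (i, j, l) = φ (i, j, l)) ∧
      (∀ i j l, i ≤ n → j ≤ n → l ≤ n → ‖logVec (su2Quat (a⁻¹ * W φ (i, j, l)))‖ ≤ π - r) ∧
      (∀ lam : ℝ, 0 ≤ lam →
        (∀ P Q : ℕ × ℕ × ℕ, P.1 ≤ n → P.2.1 ≤ n → P.2.2 ≤ n →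
          (P.1 = 0 ∨ P.1 = n ∨ P.2.1 = 0 ∨ P.2.1 = n ∨ P.2.2 = 0 ∨ P.2.2 = n) →
          Q.1 ≤ n → Q.2.1 ≤ n → Q.2.2 ≤ n →
          (Q.1 = 0 ∨ Q.1 = n ∨ Q.2.1 = 0 ∨ Q.2.1 = n ∨ Q.2.2 = 0 ∨ Q.2.2 = n) →
          dist1 (φ P * (φ Q)⁻¹) ≤ lam * ((Nat.dist P.1 Q.1 + Nat.dist P.2.1 Q.2.1 + Nat.dist P.2.2 Q.2.2 : ℕ) : ℝ)) →
        (∀ i j l, i + 1 ≤ n → j ≤ n → l ≤ n →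
          dist1 (W φ (i, j, l) * (W φ (i + 1, j, l))⁻¹) ≤ 6 * ((π - r) / Real.sin r) * lam + 3 * (π - r) / n) ∧
        (∀ i j l, i ≤ n → j + 1 ≤ n → l ≤ n →
          dist1 (W φ (i, j, l) * (W φ (i, j + 1, l))⁻¹) ≤ 6 * ((π - r) / Real.sin r) * lam + 3 * (π - r) / n) ∧
        (∀ i j l, i ≤ n → j ≤ n → l + 1 ≤ n →
          dist1 (W φ (i, j, l) * (W φ (i, j, l + 1))⁻¹) ≤ 6 * ((π - r) / Real.sin r) * lam + 3 * (π - r) / n)) ∧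
      (∀ φ' : ℕ × ℕ × ℕ → SU2, ∀ μ : ℝ,
        (∀ i j l, i ≤ n → j ≤ n → l ≤ n → (i = 0 ∨ i = n ∨ j = 0 ∨ j = n ∨ l = 0 ∨ l = n) →
          ‖logVec (su2Quat (a⁻¹ * φ' (i, j, l)))‖ ≤ π - r) →
        (∀ i j l, i ≤ n → j ≤ n → l ≤ n → (i = 0 ∨ i = n ∨ j = 0 ∨ j = n ∨ l = 0 ∨ l = n) →
          dist1 (φ (i, j, l) * (φ' (i, j, l))⁻¹) ≤ μ) →
        ∀ i j l, i ≤ n → j ≤ n → l ≤ n → dist1 (W φ (i, j, l) * (W φ' (i, j, l))⁻¹) ≤ ((π - r) / Real.sin r) * μ) := by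
  obtain ⟨dep, pr, -, hdephalf, hdep0, hprb, hprid, hdepi, hdepj, hdepl, hdisti, hdistj, hdistl⟩ := exists_cubeProjection n hn
  have hn' : 1 ≤ n / 2 := by omega
  have hΛ0 : 0 ≤ (π - r) / Real.sin r := div_nonneg (by linarith) (Real.sin_nonneg_of_nonneg_of_le_pi hr.le hrπ.le)
  have h6 : ∀ lam : ℝ, (3 : ℝ) * (2 : ℕ) * ((π - r) / Real.sin r) * lam + 3 * (π - r) / n
      = 6 * ((π - r) / Real.sin r) * lam + 3 * (π - r) / n := fun lam => by push_cast; ring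
  refine ⟨fun φ x => a * expPoint ((1 - (dep x.1 x.2.1 x.2.2 : ℝ) / (n / 2 : ℕ)) • logVec (su2Quat (a⁻¹ * φ (pr x.1 x.2.1 x.2.2)))),
    fun φ hcap => ?_⟩
  -- the datum read at the projection is a shell datum, hence off the cap
  have hq : ∀ i j l, i ≤ n → j ≤ n → l ≤ n → ‖logVec (su2Quat (a⁻¹ * φ (pr i j l)))‖ ≤ π - r := by
    intro i j l hi hj hl
    obtain ⟨hb, h1, h2, h3⟩ := hprb i j l hi hj hl
    exact hcap (pr i j l).1 (pr i j l).2.1 (pr i j l).2.2 h1 h2 h3 hb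
  refine ⟨fun i j l hi hj hl hb => ?_, fun i j l hi hj hl => ?_,
    fun lam hlam hmod => ⟨fun i j l hi hj hl => ?_, fun i j l hi hj hl => ?_, fun i j l hi hj hl => ?_⟩,
    fun φ' μ hcap' hclose i j l hi hj hl => ?_⟩
  · -- (i) boundary shell: depth `0`, projection the identity, cone parameter `1`
    have h0 : dep i j l = 0 := (hdep0 i j l hi hj hl).2 hb
    show a * expPoint ((1 - (dep i j l : ℝ) / (n / 2 : ℕ)) • logVec (su2Quat (a⁻¹ * φ (pr i j l)))) = φ (i, j, l)
    rw [hprid i j l hi hj hl hb, h0]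
    exact coneFill_zero a (φ (i, j, l)) (n / 2)
  · -- (ii) position
    exact norm_logVec_inv_mul_coneFill_le a _ (hdephalf i j l hi hj hl) (hq i j l hi hj hl)
  · -- (iii) step in the first direction
    have hi' : i ≤ n := by omega
    obtain ⟨hbx, hx1, hx2, hx3⟩ := hprb i j l hi' hj hl
    obtain ⟨hby, hy1, hy2, hy3⟩ := hprb (i + 1) j l hi hj hl
    have hkk : dep (i + 1) j l = dep i j l ∨ dep (i + 1) j l = dep i j l + 1 ∨ dep i j l = dep (i + 1) j l + 1 := by
      have := hdepi i j l; omega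
    rw [← h6]
    exact cone_step_core_mul hn hr hrπ a _ _ (hq i j l hi' hj hl) (hq (i + 1) j l hi hj hl) (hdephalf i j l hi' hj hl)
      (hdephalf (i + 1) j l hi hj hl) hkk hlam (hmod (pr i j l) (pr (i + 1) j l) hx1 hx2 hx3 hbx hy1 hy2 hy3 hby) 2
      (hdisti i j l hi hj hl)
  · -- (iii) step in the second direction
    have hj' : j ≤ n := by omega
    obtain ⟨hbx, hx1, hx2, hx3⟩ := hprb i j l hi hj' hl
    obtain ⟨hby, hy1, hy2, hy3⟩ := hprb i (j + 1) l hi hj hl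
    have hkk : dep i (j + 1) l = dep i j l ∨ dep i (j + 1) l = dep i j l + 1 ∨ dep i j l = dep i (j + 1) l + 1 := by
      have := hdepj i j l; omega
    rw [← h6]
    exact cone_step_core_mul hn hr hrπ a _ _ (hq i j l hi hj' hl) (hq i (j + 1) l hi hj hl) (hdephalf i j l hi hj' hl)
      (hdephalf i (j + 1) l hi hj hl) hkk hlam (hmod (pr i j l) (pr i (j + 1) l) hx1 hx2 hx3 hbx hy1 hy2 hy3 hby) 2
      (hdistj i j l hi hj hl)
  · -- (iii) step in the third direction
    have hl' : l ≤ n := by omega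
    obtain ⟨hbx, hx1, hx2, hx3⟩ := hprb i j l hi hj hl'
    obtain ⟨hby, hy1, hy2, hy3⟩ := hprb i j (l + 1) hi hj hl
    have hkk : dep i j (l + 1) = dep i j l ∨ dep i j (l + 1) = dep i j l + 1 ∨ dep i j l = dep i j (l + 1) + 1 := by
      have := hdepl i j l; omega
    rw [← h6]
    exact cone_step_core_mul hn hr hrπ a _ _ (hq i j l hi hj hl') (hq i j (l + 1) hi hj hl) (hdephalf i j l hi hj hl')
      (hdephalf i j (l + 1) hi hj hl) hkk hlam (hmod (pr i j l) (pr i j (l + 1)) hx1 hx2 hx3 hbx hy1 hy2 hy3 hby) 2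
      (hdistl i j l hi hj hl)
  · -- (iv) datum to datum: same depth, same projection, data `μ`-close there
    obtain ⟨hb, h1, h2, h3⟩ := hprb i j l hi hj hl
    have hq' : ‖logVec (su2Quat (a⁻¹ * φ' (pr i j l)))‖ ≤ π - r := hcap' (pr i j l).1 (pr i j l).2.1 (pr i j l).2.2 h1 h2 h3 hb
    have ht := dist1_coneFill_tangential_le hr hrπ a (φ (pr i j l)) (φ' (pr i j l)) (hq i j l hi hj hl) hq' (n := n / 2)
      (hdephalf i j l hi hj hl)
    have hk1 : 1 - (dep i j l : ℝ) / (n / 2 : ℕ) ≤ 1 := by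
      have : 0 ≤ (dep i j l : ℝ) / (n / 2 : ℕ) := by positivity
      linarith
    have hμ : dist1 (φ (pr i j l) * (φ' (pr i j l))⁻¹) ≤ μ := hclose (pr i j l).1 (pr i j l).2.1 (pr i j l).2.2 h1 h2 h3 hb
    have hμ0 : 0 ≤ μ := (GaugeGroup.dist1_nonneg _).trans hμ
    calc _ ≤ (1 - (dep i j l : ℝ) / (n / 2 : ℕ)) * ((π - r) / Real.sin r) * dist1 (φ (pr i j l) * (φ' (pr i j l))⁻¹) := ht
      _ ≤ 1 * ((π - r) / Real.sin r) * μ := by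
          apply mul_le_mul (mul_le_mul_of_nonneg_right hk1 hΛ0) hμ (GaugeGroup.dist1_nonneg _) (mul_nonneg zero_le_one hΛ0)
      _ = (π - r) / Real.sin r * μ := by rw [one_mul]

end Summit.QuantumFields.YangMills.Theorems.FluctuationComparisonRegPrIntLS2BetaConeOnCube

end
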